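import Summits.QuantumFields.BalabanUV.T4Continuum.Support.ShellMeasureLinearizedChart
import Summits.QuantumFields.BalabanUV.T4Continuum.Support.ShellMeasureLinearizedConstraint
import Summits.QuantumFields.BalabanUV.T4Continuum.Support.ShellMeasureWindowSectionToy

/-!
# `T4Continuum.ShellMeasureLinearizedToy` — NON-VACUITY of the curved fibre chart with a GENUINELY NONLINEAR average:
# the parabola-fibred block `ℝ²`, average `Q(y) = y₁ + y₀²`, print-shaped substitution `Φ(B) = B − h·D̃(B)` with
# `D̃(B) = B₀²`, Jacobian `1`; both ENDs' transport lemmas FIRE and give (M1) with the sharp constant `D = 1`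
# (cell `pub-balaban`, sub-cell `t4`, spine estimate NE7c (node U5b); NE7c ROUND-2 crew `t4-ne7c-formalise-*`, seat
# `b2b-balaban-t4-ne7c-formalise-leaf-09` (gen 7); file 3 (companion TOY) of the OFFER «the curved fibre chart for a
# linearizable average» (journal `CLAIMS.log` l.11567); ADDITIVE — imports files 1–2 `ShellMeasureLinearizedChart` /
# `ShellMeasureLinearizedConstraint` and FC f5 `ShellMeasureWindowSectionToy` (the 1-D core `slotAC_windowLebesgue`)
# only; toy data = four small `def`s; 0 sorry, 0 cite)

HONEST FRAMING.  A TOY: it asserts NOTHING about Bałaban's block averages, minimisers or densities (c3); its only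
purpose is to show that the hypothesis SHAPES of files 1–2 (`hlin`, `hinj`, `hΦ'`, the pulled-back density, the
fibre chart) are JOINTLY INHABITED by a nonlinear average — so the curved-chart ENDs are not vacuous and not secretly
the linear case — and that the transports lose nothing ((M1) with `D = 1`, the sharp constant of the 1-D core).
Finite four-torus programme, rung (B)+1 only — NOT infinite volume, NOT a mass gap, NOT the Clay problem; NE7c ⇐ the
named binders; NE7c NOT PRINTED, NOT proved; spine PROVED 0/9.  [folklore].  HONEST DEPENDENCY (cell, verbatim):
continuum YM on T⁴ ⇐ BetaPertH ∧ nine spine estimates (0/9 proved); BetaPertH ⇐ (D1) ∧ (D4) ∧ CAP+tail; G-an2-4 gates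
asym, D1 and NE2/3/4.

THE TOY.  Block `E = ℝ²` (`Fin 2 → ℝ`, Lebesgue), average space `F = ℝ`, fibre model `Kf = ℝ`; linear part
`L y = y₁` with right inverse `h b = (0, b)`; nonlinear part `C̃ y = y₀²`, so the AVERAGE is `Q y = y₁ + y₀²` (level
sets = parabolas); print's fixed-point equation `C̃(B − hD̃(B)) = D̃(B)` is solved by `D̃(B) = B₀²` (`toy_fix`), the
substitution is `Φ(B) = (B₀, B₁ − B₀²)` (`toyΦ`), with derivative `Φ'(B) = [[1, 0], [−2B₀, 1]]` (`toyΦ'`,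
`toy_hasFDerivWithinAt`) of determinant `1` (`toy_det`); `Q ∘ Φ = L` (`toy_linearizes`, = file 2's
`substitution_linearizes`), `Φ` injective (`toy_injOn`, = file 2's `substitution_injOn`); the fibre `{Q = b}` inside
the window is charted by `x ↦ Φ(h b + (x, 0)) = (x, b − x²)` (`toy_chart`, file 1's `average_linearizedChart`).
THE TWO READINGS FIRE.  Constrained: the slot law «Lebesgue on the window `|x| < r` of the linear fibre, pushed to the
parabola `x ↦ (x, b − x²)`» with tested variable `|y₀|` satisfies (M1) with `D = 1` (`toy_slotAC_constrained`; file 2's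
transport pattern ∘ FC f5's 1-D core).  Marginal: the block law `Lebesgue(ℝ²).withDensity G`,
`G y = 1{|y₀| < r} · g(Q y)` — a density that is NOT a product in the block coordinates (it depends on the nonlinear
average) — satisfies (M1) with tested variable `|y₀|` and `D = 1` for EVERY measurable `g` (`toy_slotAC_marginal`; file 1's
`slotAC_of_linearizedChart`: in the curved chart the pulled-back density IS the product `1{|x| < r} · g(b)`, and the
`b`-sections reduce to FC f5's 1-D core).
-/

noncomputable section

open Set Function MeasureTheory MeasureTheory.Measure Metric

namespace Summit.QuantumFields.BalabanUV.T4Continuum.ShellMeasureLinearizedToy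

open scoped ENNReal NNReal Matrix
open Literature.MathematicalPhysics.QuantumFieldTheory.Balaban1983to89
open T4ShellMeasure (SlotAntiConcentration)
open T4ShellMeasureLocal (slotAntiConcentration_of_sections)
open T4ShellMeasureDet (slotAntiConcentration_map)
open ShellMeasureLinearizedChart (slotAC_of_linearizedChart average_linearizedChart)
open ShellMeasureLinearizedConstraint (substitution_linearizes substitution_injOn substitution_hasFDerivWithinAt)
open ShellMeasureWindowSectionToy (slotAC_windowLebesgue)

/-! ## §1 The toy data -/

/-- the block `ℝ²`. -/
abbrev E2 : Type := Fin 2 → ℝ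

/-- the linear part of the average: `L y = y₁`. [folklore] -/
def toyL : E2 →L[ℝ] ℝ := ContinuousLinearMap.proj 1

/-- print's right inverse `h b = (0, b)` («LQ̃h = I»). [folklore] -/
def toyh : ℝ →L[ℝ] E2 := LinearMap.toContinuousLinearMap (LinearMap.single ℝ (fun _ : Fin 2 => ℝ) 1)

/-- the nonlinear part `C̃ y = y₀²` AND the fixed point `D̃ B = B₀²` (they coincide for this toy). [folklore] -/
def toyC (y : E2) : ℝ := y 0 ^ 2

/-- the derivative of the substitution at `y`: the shear matrix `[[1, 0], [−2y₀, 1]]`. [folklore] -/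
def toyΦ' (y : E2) : E2 →L[ℝ] E2 := LinearMap.toContinuousLinearMap (Matrix.toLin' !![1, 0; -2 * y 0, 1])

/-- `L y = y₁`. [folklore] -/
theorem toyL_apply (y : E2) : toyL y = y 1 := rfl

/-- `h b = (0, b)` as `Pi.single 1 b`. [folklore] -/
theorem toyh_apply (b : ℝ) : toyh b = Pi.single (1 : Fin 2) b := rfl

/-- «LQ̃h = I»: `L (h b) = b`. [folklore] -/
theorem toyLh (b : ℝ) : toyL (toyh b) = b := by
  simp [toyL_apply, toyh_apply]

/-- the substitution `Φ B = B − h D̃(B) = (B₀, B₁ − B₀²)`, coordinatewise. [folklore] -/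
theorem toyΦ_apply (B : E2) : B - toyh (toyC B) = ![B 0, B 1 - B 0 ^ 2] := by
  ext i
  fin_cases i <;> simp [toyh_apply, toyC]

/-- print's fixed-point equation `C̃(B − hD̃(B)) = D̃(B)` holds identically. [folklore] -/
theorem toy_fix (B : E2) : toyC (B - toyh (toyC B)) = toyC B := by
  rw [toyΦ_apply]; simp [toyC]

/-! ## §2 The chart hypotheses of files 1–2, inhabited -/

/-- the linear splitting `Ψ (x, b) = (x, b)` of `ℝ² ≃ ℝ × ℝ`; its second inverse coordinate is `L`. [folklore] -/
theorem toyΨ_symm (y : E2) : (((ContinuousLinearEquiv.finTwoArrow ℝ ℝ).symm).symm y).2 = toyL y := by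
  simp [toyL_apply]

/-- `Q ∘ Φ = L`: the substitution LINEARIZES the average `Q y = y₁ + y₀²` (file 2 `substitution_linearizes`).
[folklore] -/
theorem toy_linearizes (B : E2) :
    toyL (B - toyh (toyC B)) + toyC (B - toyh (toyC B)) = (((ContinuousLinearEquiv.finTwoArrow ℝ ℝ).symm).symm B).2 :=
  substitution_linearizes toyL toyh toyLh toyC toyC (O := univ) (fun B _ => toy_fix B)
    (ContinuousLinearEquiv.finTwoArrow ℝ ℝ).symm toyΨ_symm B (mem_univ B)

/-- `Φ` is injective (file 2 `substitution_injOn`). [folklore] -/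
theorem toy_injOn : InjOn (fun B : E2 => B - toyh (toyC B)) univ :=
  substitution_injOn toyh toyC toyC fun B _ => toy_fix B

/-- `D̃ B = B₀²` has derivative `v ↦ 2B₀·v₀`. [folklore] -/
theorem toyC_hasFDerivAt (B : E2) :
    HasFDerivAt toyC ((2 * B 0) • ContinuousLinearMap.proj (R := ℝ) (φ := fun _ : Fin 2 => ℝ) 0) B := by
  have h := ((ContinuousLinearMap.proj (R := ℝ) (φ := fun _ : Fin 2 => ℝ) 0).hasFDerivAt (x := B)).pow 2
  show HasFDerivAt (fun y : E2 => y 0 ^ 2) _ B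
  refine h.congr_fderiv ?_
  ext v
  simp [nsmul_eq_mul]

/-- the substitution has derivative `toyΦ' B = [[1, 0], [−2B₀, 1]]` (file 2 `substitution_hasFDerivWithinAt`, then
an identification of continuous linear maps on `ℝ²`). [folklore] -/
theorem toy_hasFDerivWithinAt (B : E2) : HasFDerivWithinAt (fun B : E2 => B - toyh (toyC B)) (toyΦ' B) univ B := by
  have h := substitution_hasFDerivWithinAt toyh toyC (O := univ) (toyC_hasFDerivAt B).hasFDerivWithinAt
  refine h.congr_fderiv ?_
  ext v i
  fin_cases i
  · simp [toyΦ', toyh_apply, Matrix.toLin'_apply, Matrix.mulVec, dotProduct, Fin.sum_univ_two]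
  · simp [toyΦ', toyh_apply, Matrix.toLin'_apply, Matrix.mulVec, dotProduct, Fin.sum_univ_two]; ring

/-- the Jacobian is `1`. [folklore] -/
theorem toy_det (B : E2) : (toyΦ' B).det = 1 := by
  simp [toyΦ', ContinuousLinearMap.det, LinearMap.det_toLin', Matrix.det_fin_two_of]

/-- THE CURVED FIBRE CHART: with the section `b ↦ h b`, the charted point is `(x, b − x²)` and HAS AVERAGE `b`
(file 1 `average_linearizedChart`) — the fibres of `Q` are parabolas. [folklore] -/
theorem toy_chart (x b : ℝ) :
    toyh b + (ContinuousLinearEquiv.finTwoArrow ℝ ℝ).symm (x, 0) - toyh (toyC (toyh b +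
      (ContinuousLinearEquiv.finTwoArrow ℝ ℝ).symm (x, 0))) = ![x, b - x ^ 2] ∧
    toyL (toyh b + (ContinuousLinearEquiv.finTwoArrow ℝ ℝ).symm (x, 0) - toyh (toyC (toyh b +
      (ContinuousLinearEquiv.finTwoArrow ℝ ℝ).symm (x, 0)))) + toyC (toyh b +
      (ContinuousLinearEquiv.finTwoArrow ℝ ℝ).symm (x, 0) - toyh (toyC (toyh b +
      (ContinuousLinearEquiv.finTwoArrow ℝ ℝ).symm (x, 0)))) = b := by
  refine ⟨?_, ?_⟩
  · rw [toyΦ_apply]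
    ext i
    fin_cases i <;> simp [toyh_apply]
  · exact average_linearizedChart (ContinuousLinearEquiv.finTwoArrow ℝ ℝ).symm (σ := fun b => toyh b)
      (fun b => by simp [toyh_apply]) (O := univ) (Φ := fun B : E2 => B - toyh (toyC B))
      (Q := fun y => toyL y + toyC y) (fun B hB => toy_linearizes B) x b (mem_univ _)

/-! ## §3 Both readings fire: (M1) with `D = 1` -/

/-- **CONSTRAINED READING FIRES.**  The slot law «Lebesgue on the window `|x| < r` of the linear fibre `ker L = ℝ`,
pushed to the parabola `x ↦ (x, b − x²)` = the fibre `{Q = b}`» with tested variable `|y₀|` satisfies (M1) with the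
SHARP `D = 1` for every `θ`, every `0 ≤ ρ ≤ 1`, every window radius `r > 0` and every average value `b` — FC f5's
1-D core `slotAC_windowLebesgue` transported by `T4ShellMeasureDet.slotAntiConcentration_map` (file 2's pattern).
[folklore] -/
theorem toy_slotAC_constrained {r θ ρ : ℝ} (hr : 0 < r) (hρ0 : 0 ≤ ρ) (hρ1 : ρ ≤ 1) (b : ℝ) :
    SlotAntiConcentration (((volume : Measure ℝ).restrict {x : ℝ | |x| < r}).map fun x : ℝ => (![x, b - x ^ 2] : E2))
      (fun y : E2 => |y 0|) θ ρ 1 := by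
  have hm : Measurable fun x : ℝ => (![x, b - x ^ 2] : E2) :=
    measurable_pi_iff.2 fun i => by fin_cases i <;> simp <;> fun_prop
  have hu : Measurable fun y : E2 => |y 0| := continuous_abs.measurable.comp (measurable_pi_apply 0)
  have key : ((fun y : E2 => |y 0|) ∘ fun x : ℝ => (![x, b - x ^ 2] : E2)) = fun x => |x| := by
    funext x; simp
  have h1 := slotAC_windowLebesgue (θ := θ) hr hρ0 hρ1
  rw [← key] at h1
  exact slotAntiConcentration_map hm hu h1

/-- **MARGINAL READING FIRES.**  The block law `Lebesgue(ℝ²).withDensity G` with `G y = 1{|y₀| < r} · g(y₁ + y₀²)` —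
NOT a product in the block coordinates — and tested variable `|y₀|` satisfies (M1) with `D = 1` (any measurable `g`):
file 1's `slotAC_of_linearizedChart` with the toy chart, under which the pulled-back density IS the product
`1{|x| < r} · g(b)` (Jacobian `1`), and sections over the average value `b`. [folklore] -/
theorem toy_slotAC_marginal {r θ ρ : ℝ} (hr : 0 < r) (hρ0 : 0 ≤ ρ) (hρ1 : ρ ≤ 1) {g : ℝ → ℝ≥0∞}
    (hg : Measurable g) :
    SlotAntiConcentration ((volume : Measure E2).withDensity fun y => {y : E2 | |y 0| < r}.indicator 1 y * g (y 1 + y 0 ^ 2))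
      (fun y : E2 => |y 0|) θ ρ 1 := by
  -- measurability of the toy objects
  have hΦm : Measurable fun B : E2 => B - toyh (toyC B) :=
    measurable_id.sub (toyh.continuous.measurable.comp ((measurable_pi_apply 0).pow_const 2))
  have hwin : MeasurableSet {y : E2 | |y 0| < r} :=
    measurableSet_lt (continuous_abs.measurable.comp (measurable_pi_apply 0)) measurable_const
  have hG : Measurable fun y : E2 => {y : E2 | |y 0| < r}.indicator 1 y * g (y 1 + y 0 ^ 2) :=
    ((measurable_one.indicator hwin).mul (hg.comp ((measurable_pi_apply 1).add ((measurable_pi_apply 0).pow_const 2))))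
  have hu : Measurable fun y : E2 => |y 0| := continuous_abs.measurable.comp (measurable_pi_apply 0)
  -- the image of the window-free chart is everything
  have himage : (fun B : E2 => B - toyh (toyC B)) '' univ = univ := by
    refine eq_univ_of_forall fun y => ⟨y + toyh (toyC y), mem_univ _, ?_⟩
    have hc : toyC (y + toyh (toyC y)) = toyC y := by simp [toyC, toyh_apply]
    show (y + toyh (toyC y)) - toyh (toyC (y + toyh (toyC y))) = y
    rw [hc, add_sub_cancel_right]
  have hres : (volume : Measure E2).withDensity
      (fun y => {y : E2 | |y 0| < r}.indicator 1 y * g (y 1 + y 0 ^ 2)) =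
      ((volume : Measure E2).restrict ((fun B : E2 => B - toyh (toyC B)) '' univ)).withDensity
        fun y => {y : E2 | |y 0| < r}.indicator 1 y * g (y 1 + y 0 ^ 2) := by
    rw [himage, Measure.restrict_univ]
  rw [hres]
  -- the pulled-back density: Jacobian 1, and `G ∘ Φ` reads `1{|B₀| < r} · g(B₁)`
  have hGt : ∀ y : E2, {y : E2 | |y 0| < r}.indicator 1 y * g (y 1) = (univ : Set E2).indicator
      (fun y => ENNReal.ofReal |(toyΦ' y).det| *
        ({y : E2 | |y 0| < r}.indicator 1 (y - toyh (toyC y)) * g ((y - toyh (toyC y)) 1 + (y - toyh (toyC y)) 0 ^ 2)))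
      y := fun y => by
    rw [indicator_univ, toy_det, toyΦ_apply]
    simp [indicator]
  refine slotAC_of_linearizedChart (volume : Measure E2) (volume : Measure ℝ) (volume : Measure ℝ)
    (ContinuousLinearEquiv.finTwoArrow ℝ ℝ).symm (σ := fun b => toyh b) toyh.continuous.measurable
    (fun b => by simp [toyh_apply]) MeasurableSet.univ hΦm toy_injOn (fun B _ => toy_hasFDerivWithinAt B) _
    (Gt := fun y : E2 => {y : E2 | |y 0| < r}.indicator 1 y * g (y 1))
    ((measurable_one.indicator hwin).mul (hg.comp (measurable_pi_apply 1))) hGt hu ?_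
  -- in the chart: the product density `1{|x| < r} · g(b)` and the variable `|x|`; sections over `b`, 1-D core
  have hS : MeasurableSet {x : ℝ | |x| < r} := measurableSet_lt continuous_abs.measurable measurable_const
  have hfinal : SlotAntiConcentration (((volume : Measure ℝ).prod (volume : Measure ℝ)).withDensity
      fun p : ℝ × ℝ => {x : ℝ | |x| < r}.indicator 1 p.1 * g p.2) (fun p : ℝ × ℝ => |p.1|) θ ρ 1 := by
    refine slotAntiConcentration_of_sections (volume : Measure ℝ) (volume : Measure ℝ)
      (f := fun p : ℝ × ℝ => {x : ℝ | |x| < r}.indicator 1 p.1 * g p.2)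
      (((measurable_one.indicator hS).comp measurable_fst).mul (hg.comp measurable_snd))
      (continuous_abs.measurable.comp measurable_fst) fun b => ?_
    -- one section: `(1{|x|<r} · g b) dx = g b • Lebesgue⌞window`; the constant cancels in (M1)
    have hsec : (volume : Measure ℝ).withDensity (fun x => {x : ℝ | |x| < r}.indicator 1 x * g b) =
        g b • (volume : Measure ℝ).restrict {x : ℝ | |x| < r} := by
      rw [← withDensity_indicator_one hS, ← withDensity_smul (g b) (measurable_one.indicator hS)]
      congr 1
      funext x
      simp [mul_comm]
    rw [hsec]
    have h1 := slotAC_windowLebesgue (θ := θ) hr hρ0 hρ1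
    unfold SlotAntiConcentration at h1 ⊢
    rw [Measure.smul_apply, Measure.smul_apply, smul_eq_mul, smul_eq_mul, mul_left_comm]
    exact mul_le_mul_right h1 _
  have hpt : ∀ p : ℝ × ℝ, toyh p.2 + (ContinuousLinearEquiv.finTwoArrow ℝ ℝ).symm (p.1, 0) = ![p.1, p.2] :=
    fun p => by ext i; fin_cases i <;> simp [toyh_apply]
  convert hfinal using 2
  · funext p
    simp only [hpt]
    simp [indicator]
  · simp only [toyΦ_apply, hpt]
    simp

end Summit.QuantumFields.BalabanUV.T4Continuum.ShellMeasureLinearizedToy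

end
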